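import Summits.AtomisticToContinuum.FouriersLaw.Theorems.BondHeatUncertaintyBoundedResponseBathHeatCumulantD
import HarnessLib

/-!
# Bounded response, bath heat: WickDefect / CumulantChannels (lens-1 NODE 108) — part 5 of 5 (sequel of `…BondHeatUncertaintyBoundedResponseBathHeatCumulantD`)

Split for the 400-line cap by the landing lane (hand-2 g39); the module docstring of part 1 (`…BondHeatUncertaintyBoundedResponseBathHeatCumulantA`) describes the whole node.  Same namespace; all FQNs unchanged.
0 sorry; standard axioms.
-/

noncomputable section
open MeasureTheory ProbabilityTheory Filter Topology Set Function
open scoped NNReal ENNReal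
open Literature.MathematicalPhysics.KineticTheory.HeatConduction
open Literature.MathematicalPhysics.KineticTheory OscillatorChain
open Literature.Probability.Process
open Summit.AtomisticToContinuum.FouriersLaw.Theorems.SubdiffusiveBondHeat
open Summit.AtomisticToContinuum.FouriersLaw.Theorems.SubdiffusiveBondHeat.EscapeGrading
open Summit.AtomisticToContinuum.FouriersLaw.Theorems.IncoherentChannel.Negative.KernelMoments
  (integrable_sq_momentum_transitionKernel harmonic_kernel_momentum harmonic_kernel_momentum_sq)
open Summit.AtomisticToContinuum.FouriersLaw.Theorems.IncoherentChannel.Negative.HarmonicFlow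
  (harmonic_chainFlow_zero_noise_linear integral_gibbsMeasure_eq_zero_of_odd)
open Summit.AtomisticToContinuum.FouriersLaw.Theorems.IncoherentChannel.Negative.GibbsStein
  (integrable_gibbsMeasure_of_growth pow_le_one_add_sq_sq gibbs_sq_momentum gibbs_momentum_mul_clm gibbs_sq_momentum_mul_clm_sq)
open Summit.AtomisticToContinuum.FouriersLaw.Cruxes.SuperadditiveResistance.FloatingProbeBypassLaplacian
  (integral_flip_gibbsMeasure integrable_flip_gibbsMeasure)

namespace Summit.AtomisticToContinuum.FouriersLaw.Theorems.BoundedResponse.HeatSpreading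

open Summit.AtomisticToContinuum.FouriersLaw.Theses.BondHeatUncertainty (BoundedResponse SubdiffusiveBondHeat)
open Summit.AtomisticToContinuum.FouriersLaw.Theorems.BoundedResponse.TransientBand
  (escapeKernel escapeTransient warburgDip TransientFloor WarburgDipFloor transientFloor_one_of_warburgDipFloor)

/-! ## §10 Addendum (g108 rev 2): the common-past channel is floored by FORECASTABILITY

`f_N(t) := ‖P_t p₀‖²_{L²(μ_T)} = ∫ m_t² dμ_T = T − E_{μ_T}[V_t]` (law of total variance) is the FORECASTABILITY of the boundary momentum.
Unconditionally (every `lam, β > 0`, `N ≥ 1`, `t`):  `CP_N(t) ≥ −T·f_N(t)` (because `θ = p₀² − T ≥ −T` and `m_t² ≥ 0`),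
`c_N(t)² ≤ T·f_N(t)` (Cauchy–Schwarz), hence `SQ_N(t) ≥ −3T·f_N(t)` and `K_N(t) ≥ VC_N(t) − T·f_N(t)`.  So the ONLY way the
common-past channel can pull the kernel below the variance channel is through momentum that is STILL FORECASTABLE at time `t`;
an `N`-uniform decay (FNᶜ_{p,α}) `BathForecastDecay` of `f_N` gives (CPᶠ), (SQᶠ) AND the certificate (MDᶜ) at once, and with (VCᶠ) the
blocker.  (FNᶜ) is phonon-FALSE as an `N`-uniform statement (harmonic forecastability is transported ballistically and only absorbed at the
baths: `f_N` decays at fixed `N` but not uniformly) and chaotic-TRUE-leaning (local scrambling of the `S`-odd information near the boundary by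
bath noise + anharmonicity, `S : (q,p) ↦ (−q,−p)`; `m_t` is `S`-odd and has no hydrodynamic component) — it is the typed form of «what replaces
Gaussianity anharmonically»: CHAOTIC LOSS OF FORECASTABILITY kills the common-past channel, leaving the variance channel (heat return) alone.
The phonon-robust door stays `(CPᶠ) ∧ (VCᶠ)`; (FNᶜ) is the chaotic-regime engine for its first factor. -/

/-- **`f_N(t) = bathFcastNorm`** `:= ∫ m_t(z)² dμ_T(z) = ‖P_t p₀‖²_{L²(μ_T)}`, the forecastability of the boundary momentum at horizon `t`
(`dite` on `0 < N`, junk `0`; `t ↦ t⁺`). [formal bookkeeping] -/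
def bathFcastNorm (ω₂ lam β γ T : ℝ) (N : ℕ) (t : ℝ) : ℝ :=
  if h : 0 < N then
    ∫ z, (∫ y, y.2 ⟨0, h⟩ ∂((pinnedChain ω₂ lam β γ).transitionKernel N T T t.toNNReal z)) ^ 2
      ∂((pinnedChain ω₂ lam β γ).gibbsMeasure N T)
  else 0

/-- **(FNᶜ_{p,α}) `BathForecastDecay p α`** — `∃ A, t₀ > 0, N₀: ∀ N ≥ N₀ ∀ t ≥ t₀, f_N(t) ≤ A·N^p·t^{−α}`: the boundary momentum is
`N`-uniformly unforecastable beyond `t₀` (equivalently `E_{μ_T}[V_t] ≥ T − A N^p t^{−α}`: the conditional variance saturates).  A CEILING-type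
certificate: phonon-FALSE `N`-uniformly, chaotic-TRUE-leaning; implies (CPᶠ), (SQᶠ), (MDᶜ) (`bathCommonPastFloor_of_forecastDecay`, …).
Tag: UNDECIDED · certificate · phonon-FALSE · INSTRUMENTABLE (FORK-108: `f_N = T − E V_t`, or directly `E_z[(p₀^{(1)}(t) p₀^{(2)}(t))]`).
[route statement · this cell; NOT a literature fact] -/
def BathForecastDecay (p α : ℝ) : Prop :=
  ∀ ω₂ lam β γ : ℝ, 0 < ω₂ → 0 < lam → 0 < β → 0 < γ → ∀ T : ℝ, 0 < T →
    ∃ A t₀ : ℝ, 0 < t₀ ∧ ∃ N₀ : ℕ, ∀ N : ℕ, N₀ ≤ N → ∀ t : ℝ, t₀ ≤ t →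
      bathFcastNorm ω₂ lam β γ T N t ≤ A * (N : ℝ) ^ p * t ^ (-α)

section ForecastNorm

variable {ω₂ lam β γ : ℝ} (hω : 0 < ω₂) (hl : 0 < lam) (hβ : 0 < β) (hγ : 0 < γ) {T : ℝ} (hT : 0 < T)
include hω hl hβ hγ hT

/-- `0 ≤ f_N(t) ≤ T` (`N ≥ 1`). [formal bookkeeping] -/
theorem bathFcastNorm_nonneg_and_le {N : ℕ} (hN : 0 < N) (t : ℝ) :
    0 ≤ bathFcastNorm ω₂ lam β γ T N t ∧ bathFcastNorm ω₂ lam β γ T N t ≤ T := by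
  obtain ⟨n, rfl⟩ : ∃ n, N = n + 1 := ⟨N - 1, by omega⟩
  unfold bathFcastNorm
  rw [dif_pos (Nat.succ_pos n)]
  exact ⟨integral_nonneg fun _ => sq_nonneg _, (integrable_sq_momFcast_and_le hω hl hβ hγ hT n t.toNNReal).2⟩

/-- **`f_N(t) = T − E_{μ_T}[V_t]`** (law of total variance). [folklore] -/
theorem bathFcastNorm_eq_T_sub_integral_condVar (n : ℕ) (t : ℝ) :
    bathFcastNorm ω₂ lam β γ T (n + 1) t =
      T - ∫ z, ((∫ y, y.2 0 ^ 2 ∂((pinnedChain ω₂ lam β γ).transitionKernel (n + 1) T T t.toNNReal z)) - (∫ y, y.2 0 ∂((pinnedChain ω₂ lam β γ).transitionKernel (n + 1) T T t.toNNReal z)) ^ 2) ∂((pinnedChain ω₂ lam β γ).gibbsMeasure (n + 1) T) := by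
  rw [integral_condVar_eq hω hl hβ hγ hT n t.toNNReal]
  unfold bathFcastNorm
  rw [dif_pos (Nat.succ_pos n)]
  show ∫ z, (∫ y, y.2 0 ∂((pinnedChain ω₂ lam β γ).transitionKernel (n + 1) T T t.toNNReal z)) ^ 2 ∂((pinnedChain ω₂ lam β γ).gibbsMeasure (n + 1) T) = T - (T - ∫ z, (∫ y, y.2 0 ∂((pinnedChain ω₂ lam β γ).transitionKernel (n + 1) T T t.toNNReal z)) ^ 2 ∂((pinnedChain ω₂ lam β γ).gibbsMeasure (n + 1) T))
  ring

/-- ★ **`CP_N(t) ≥ −T·f_N(t)`** — the common-past channel is floored by forecastability (`θ ≥ −T`, `m_t² ≥ 0`). [this cell] -/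
theorem bathCommonPast_ge_neg_fcastNorm {N : ℕ} (hN : 0 < N) (t : ℝ) :
    -(T * bathFcastNorm ω₂ lam β γ T N t) ≤ bathCommonPast ω₂ lam β γ T N t := by
  obtain ⟨n, rfl⟩ : ∃ n, N = n + 1 := ⟨N - 1, by omega⟩
  have hθm := integrable_kinObs_mul_sq_momFcast hω hl hβ hγ hT n t.toNNReal
  have hm2 := (integrable_sq_momFcast_and_le hω hl hβ hγ hT n t.toNNReal).1
  unfold bathCommonPast bathFcastNorm
  rw [dif_pos (Nat.succ_pos n), dif_pos (Nat.succ_pos n)]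
  show -(T * ∫ z, (∫ y, y.2 0 ∂((pinnedChain ω₂ lam β γ).transitionKernel (n + 1) T T t.toNNReal z)) ^ 2 ∂((pinnedChain ω₂ lam β γ).gibbsMeasure (n + 1) T)) ≤ ∫ z, (z.2 0 ^ 2 - T) * (∫ y, y.2 0 ∂((pinnedChain ω₂ lam β γ).transitionKernel (n + 1) T T t.toNNReal z)) ^ 2 ∂((pinnedChain ω₂ lam β γ).gibbsMeasure (n + 1) T)
  have h := integral_mono (hm2.const_mul (-T)) hθm fun z => by
    dsimp only
    nlinarith [mul_nonneg (sq_nonneg (z.2 0)) (sq_nonneg (∫ y, y.2 0 ∂((pinnedChain ω₂ lam β γ).transitionKernel (n + 1) T T t.toNNReal z)))]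
  rw [integral_const_mul] at h
  linarith

/-- ★ **`c_N(t)² ≤ T·f_N(t)`** (Cauchy–Schwarz: `c = ⟨p₀, m_t⟩`, `∫ p₀² = T`). [folklore] -/
theorem bathMomCorr_sq_le_fcastNorm {N : ℕ} (hN : 0 < N) (t : ℝ) :
    (bathMomCorr ω₂ lam β γ T N t) ^ 2 ≤ T * bathFcastNorm ω₂ lam β γ T N t := by
  obtain ⟨n, rfl⟩ : ∃ n, N = n + 1 := ⟨N - 1, by omega⟩
  have h2 := PhononMeanFreePath.lightCone_integrable_momentum_pow (γ := γ) hω hl.le hβ.le hT (0 : Fin (n + 1)) 2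
  have hp2 := pinnedChain_integral_sq_momentum_gibbsMeasure hω hl.le hβ.le γ (n + 1) hT (0 : Fin (n + 1))
  have hm2 := (integrable_sq_momFcast_and_le hω hl hβ hγ hT n t.toNNReal).1
  have hpm := integrable_mom_mul_momFcast hω hl hβ hγ hT n t.toNNReal
  unfold bathMomCorr bathFcastNorm
  rw [dif_pos (Nat.succ_pos n), dif_pos (Nat.succ_pos n)]
  show (∫ z, z.2 0 * (∫ y, y.2 0 ∂((pinnedChain ω₂ lam β γ).transitionKernel (n + 1) T T t.toNNReal z)) ∂((pinnedChain ω₂ lam β γ).gibbsMeasure (n + 1) T)) ^ 2 ≤ T * ∫ z, (∫ y, y.2 0 ∂((pinnedChain ω₂ lam β γ).transitionKernel (n + 1) T T t.toNNReal z)) ^ 2 ∂((pinnedChain ω₂ lam β γ).gibbsMeasure (n + 1) T)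
  have key : ∀ s : ℝ, 0 ≤ T * (s * s) + (2 * ∫ z, z.2 0 * (∫ y, y.2 0 ∂((pinnedChain ω₂ lam β γ).transitionKernel (n + 1) T T t.toNNReal z)) ∂((pinnedChain ω₂ lam β γ).gibbsMeasure (n + 1) T)) * s + ∫ z, (∫ y, y.2 0 ∂((pinnedChain ω₂ lam β γ).transitionKernel (n + 1) T T t.toNNReal z)) ^ 2 ∂((pinnedChain ω₂ lam β γ).gibbsMeasure (n + 1) T) := by
    intro s
    have h0 : 0 ≤ ∫ z, (s * z.2 0 + (∫ y, y.2 0 ∂((pinnedChain ω₂ lam β γ).transitionKernel (n + 1) T T t.toNNReal z))) ^ 2 ∂((pinnedChain ω₂ lam β γ).gibbsMeasure (n + 1) T) := integral_nonneg fun _ => sq_nonneg _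
    have hcalc : ∫ z, (s * z.2 0 + (∫ y, y.2 0 ∂((pinnedChain ω₂ lam β γ).transitionKernel (n + 1) T T t.toNNReal z))) ^ 2 ∂((pinnedChain ω₂ lam β γ).gibbsMeasure (n + 1) T) =
        s ^ 2 * T + 2 * s * (∫ z, z.2 0 * (∫ y, y.2 0 ∂((pinnedChain ω₂ lam β γ).transitionKernel (n + 1) T T t.toNNReal z)) ∂((pinnedChain ω₂ lam β γ).gibbsMeasure (n + 1) T)) + ∫ z, (∫ y, y.2 0 ∂((pinnedChain ω₂ lam β γ).transitionKernel (n + 1) T T t.toNNReal z)) ^ 2 ∂((pinnedChain ω₂ lam β γ).gibbsMeasure (n + 1) T) := by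
      have hfun : (fun z : PhaseSpace (n + 1) => (s * z.2 0 + (∫ y, y.2 0 ∂((pinnedChain ω₂ lam β γ).transitionKernel (n + 1) T T t.toNNReal z))) ^ 2) =
          fun z => s ^ 2 * z.2 0 ^ 2 + 2 * s * (z.2 0 * (∫ y, y.2 0 ∂((pinnedChain ω₂ lam β γ).transitionKernel (n + 1) T T t.toNNReal z))) + (∫ y, y.2 0 ∂((pinnedChain ω₂ lam β γ).transitionKernel (n + 1) T T t.toNNReal z)) ^ 2 := by
        funext z; ring
      have h12 : Integrable (fun z : PhaseSpace (n + 1) => s ^ 2 * z.2 0 ^ 2 + 2 * s * (z.2 0 * (∫ y, y.2 0 ∂((pinnedChain ω₂ lam β γ).transitionKernel (n + 1) T T t.toNNReal z)))) ((pinnedChain ω₂ lam β γ).gibbsMeasure (n + 1) T) :=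
        (h2.const_mul _).add (hpm.const_mul _)
      rw [hfun, integral_add h12 hm2, integral_add (h2.const_mul _) (hpm.const_mul _),
        integral_const_mul, integral_const_mul, hp2]
    nlinarith [h0, hcalc]
  have hd := discrim_le_zero key
  rw [discrim] at hd
  nlinarith [hd]

/-- `SQ_N(t) ≥ −3T·f_N(t)`. [this cell] -/
theorem bathStaticCumulant_ge_neg_fcastNorm {N : ℕ} (hN : 0 < N) (t : ℝ) :
    -(3 * T * bathFcastNorm ω₂ lam β γ T N t) ≤ bathStaticCumulant ω₂ lam β γ T N t := by
  unfold bathStaticCumulant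
  nlinarith [bathCommonPast_ge_neg_fcastNorm hω hl hβ hγ hT hN t, bathMomCorr_sq_le_fcastNorm hω hl hβ hγ hT hN t]

/-- ★ **`K_N(t) ≥ VC_N(t) − T·f_N(t)`**: the kernel sits above the variance channel up to the forecastability. [this cell] -/
theorem bathKinCorr_ge_varChannel_sub_fcastNorm {N : ℕ} (hN : 0 < N) (t : ℝ) :
    bathVarChannel ω₂ lam β γ T N t - T * bathFcastNorm ω₂ lam β γ T N t ≤ bathKinCorr ω₂ lam β γ T N t := by
  rw [bathKinCorr_eq_commonPast_add_varChannel hω hl hβ hγ hT hN t]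
  linarith [bathCommonPast_ge_neg_fcastNorm hω hl hβ hγ hT hN t]

end ForecastNorm

/-- ★ **(FNᶜ_{p,α}) ⟹ (CPᶠ_{p,α})** (constant `T·A`). [this cell] -/
theorem bathCommonPastFloor_of_forecastDecay {p α : ℝ} (hF : BathForecastDecay p α) : BathCommonPastFloor p α := by
  intro ω₂ lam β γ hω hl hβ hγ T hT
  obtain ⟨A, t₀, ht₀, N₀, hA⟩ := hF ω₂ lam β γ hω hl hβ hγ T hT
  refine ⟨T * A, t₀, ht₀, max N₀ 1, fun N hN t ht => ?_⟩
  have hN1 : 0 < N := lt_of_lt_of_le Nat.one_pos (le_trans (le_max_right _ _) hN)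
  have h := hA N (le_trans (le_max_left _ _) hN) t ht
  have hc := bathCommonPast_ge_neg_fcastNorm hω hl hβ hγ hT hN1 t
  nlinarith [mul_le_mul_of_nonneg_left h hT.le]

/-- **(FNᶜ_{p,α}) ⟹ (SQᶠ_{p,α})** (constant `3T·A`). [this cell] -/
theorem bathStaticCumulantFloor_of_forecastDecay {p α : ℝ} (hF : BathForecastDecay p α) : BathStaticCumulantFloor p α := by
  intro ω₂ lam β γ hω hl hβ hγ T hT
  obtain ⟨A, t₀, ht₀, N₀, hA⟩ := hF ω₂ lam β γ hω hl hβ hγ T hT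
  refine ⟨3 * T * A, t₀, ht₀, max N₀ 1, fun N hN t ht => ?_⟩
  have hN1 : 0 < N := lt_of_lt_of_le Nat.one_pos (le_trans (le_max_right _ _) hN)
  have h := hA N (le_trans (le_max_left _ _) hN) t ht
  have hc := bathStaticCumulant_ge_neg_fcastNorm hω hl hβ hγ hT hN1 t
  nlinarith [mul_le_mul_of_nonneg_left h hT.le]

/-- **(FNᶜ_{p,α}) ⟹ (MDᶜ_{p,α})** (constant `T·A`; `r₀ := t₀`). [this cell] -/
theorem bathMomentumDecay_of_forecastDecay {p α : ℝ} (hF : BathForecastDecay p α) : BathMomentumDecay p α := by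
  intro ω₂ lam β γ hω hl hβ hγ T hT
  obtain ⟨A, t₀, ht₀, N₀, hA⟩ := hF ω₂ lam β γ hω hl hβ hγ T hT
  refine ⟨T * A, t₀, ht₀, max N₀ 1, fun N hN r hr => ?_⟩
  have hN1 : 0 < N := lt_of_lt_of_le Nat.one_pos (le_trans (le_max_right _ _) hN)
  have h := hA N (le_trans (le_max_left _ _) hN) r hr
  have hc := bathMomCorr_sq_le_fcastNorm hω hl hβ hγ hT hN1 r
  nlinarith [mul_le_mul_of_nonneg_left h hT.le]

/-- ★★ **(S) ∧ (FNᶜ_{0,3/2}) ∧ (VCᶠ_{0,3/2}) ⟹ 11071** — the chaotic-regime door: beneath (S), `N`-uniform loss of boundary-momentum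
forecastability plus the variance-channel floor close the blocker. [this cell] -/
theorem boundedResponse_of_subdiffusiveBondHeat_forecastDecay_varChannel (hS : SubdiffusiveBondHeat) (hF : BathForecastDecay 0 (3 / 2))
    (hV : BathVarChannelFloor 0 (3 / 2)) : BoundedResponse :=
  boundedResponse_of_subdiffusiveBondHeat_commonPast_varChannel hS (bathCommonPastFloor_of_forecastDecay hF) hV

/-- **(FNᶜ) also upgrades (BKᶠ) to (CFᶠ)** (through (MDᶜ)): `(BKᶠ_{p,α}) ∧ (FNᶜ_{p,α}) ⟹ (CFᶠ_{p,α})`. [this cell] -/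
theorem bathCumulantFloor_of_bathKernelFloor_forecastDecay {p α : ℝ} (hK : BathKernelFloor p α) (hF : BathForecastDecay p α) :
    BathCumulantFloor p α :=
  bathCumulantFloor_of_bathKernelFloor_bathMomentumDecay hK (bathMomentumDecay_of_forecastDecay hF)

end Summit.AtomisticToContinuum.FouriersLaw.Theorems.BoundedResponse.HeatSpreading
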